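import Literature.NumberTheory.LFunctions.SchoenfeldZerosLow
import HarnessLib

/-!
# RH-FREE — Fiori–Kadiri–Swidinsky 2023, Table 1, rows `T₀ = 100` and `T₀ = 1000`, in the kernel's arithmetic («nothing here bears on the truth of RH»)

Topic `Literature/NumberTheory/LFunctions` (RH literature-typing tranche 1, L4 "explicit zero
statistics", gen 5; computational lane). THEOREMS only (no named facts): the first two rows of
Fiori–Kadiri–Swidinsky, J. Math. Anal. Appl. 527 (2023) 127426, **Table 1** with eq. (2.4),

  `S₀ − 10⁻¹⁰ < Σ_{0<γ<T₀} 1/γ < S₀`,  `(T₀, S₀) = (100, 0.5922435112), (1000, 2.0286569752)`,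

computed there from Platt's zeros (LMFDB), are re-proved here from the tree's CERTIFIED first
`2000` zeros (`SchoenfeldZerosLow.lean`: brackets `γ_j ∈ [a_j, a_j + 1]·2⁻²⁴⁰`, all zeros below
`2516` simple and on the line, `N(2516) = 2000`) — an independent kernel check of the published
values (margins: `S₀ − Σ ≈ 3.6·10⁻¹¹`, `5.4·10⁻¹¹`; `Σ − (S₀ − 10⁻¹⁰) ≈ 6.4·10⁻¹¹`, `4.6·10⁻¹¹`):

* `FioriKadiriSwidinsky2023_table2_row100`, `FioriKadiriSwidinsky2023_table2_row1000` — exactly the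
  two corresponding instances of the named fact
  `Literature.NumberTheory.LFunctions.FioriKadiriSwidinsky2023_table2`
  (`ZetaZeroReciprocalSumsExplicit.lean`): every truncation `Σ_{0<γ≤T} m(ρ)/γ` with `T < T₀` is
  `< S₀`, and one of them is `> S₀ − 10⁻¹⁰`;
* the integer arithmetic: `SchoenfeldBound.invOrdSumLo` (lower companion of the tree's
  `invOrdSum`: `⌊2³⁰⁰/(a_j+1)⌋ ≤ 2⁶⁰/t₂ⱼ ≤ 2⁶⁰/γ_j`), one `native_decide` evaluation
  `SchoenfeldBound.recipTable2_check` (declared `computational`), and the identification of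
  `zerosBetween 0 T` with `{½ + iγ_j : j < n}` for `γ_{n−1} ≤ T < γ_n`
  (`SchoenfeldBound.zerosBetween_zero_eq_image`; `n = 29` at `T ∈ [99, 100]`, `n = 649` at
  `T ∈ [999.9, 1000]`, i.e. `N(100) = 29`, `N(1000) = 649`).

Nothing here bears on the truth of RH.

NUMBERING (audited 2026-08-27 against the compiled arXiv v3 PDF): the table of values `S₀` is
**Table 1** and its bracket `S₀ − 10⁻¹⁰ < Σ < S₀` is eq. (2.4); the declaration names `…_table2_row…`,
`recipTable2_check` keep the label of an earlier miscount (the fact `FioriKadiriSwidinsky2023_table2`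
they instantiate is Table 1).

## References

* A. Fiori, H. Kadiri, J. Swidinsky, J. Math. Anal. Appl. 527 (2023) 127426 (arXiv:2204.02588v3),
  §2.1 Table 1 and eq. (2.4). [FioriKadiriSwidinsky2023]
* A. M. Odlyzko, H. J. J. te Riele, J. reine angew. Math. 357 (1985), §4.2 (the first `2000` zeros;
  the tree's certificate). [OdlyzkoTeRiele1985]
-/

noncomputable section

open Complex Filter Set
open scoped Real

namespace Literature.NumberTheory.LFunctions

namespace SchoenfeldBound

open NicolasJExplicit ZetaNumerics.Mertens MertensCertificate.ZetaNumerics.Mertens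
  Literature.NumberTheory.LFunctions.MertensZeroCertificate

/-! ### Integer arithmetic: a lower companion of `invOrdSum` and the compiled evaluation -/

/-- `⌊2³⁰⁰/(a_j + 1)⌋ ≤ 2⁶⁰ · 2²⁴⁰/(a_j + 1) = 2⁶⁰/t₂ⱼ` (lower companion of `invOrdTerm`).
[cite: OdlyzkoTeRiele1985, §4.2 p. 151] -/
def invOrdTermLo (j : ℕ) : ℕ := 2 ^ 300 / ((ordinate j).toNat + 1)

/-- `invOrdSumLo n = ∑_{j < n} invOrdTermLo j`. [cite: OdlyzkoTeRiele1985, §4.2 p. 151] -/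
def invOrdSumLo : ℕ → ℕ
  | 0 => 0
  | n + 1 => invOrdSumLo n + invOrdTermLo n

/-- `invOrdSumLo n = ∑_{j<n} invOrdTermLo j`. [cite: OdlyzkoTeRiele1985, §4.2 p. 151] -/
theorem invOrdSumLo_eq (n : ℕ) : invOrdSumLo n = ∑ j ∈ Finset.range n, invOrdTermLo j := by
  induction n with
  | zero => rfl
  | succ n ih => rw [invOrdSumLo, ih, Finset.sum_range_succ]

/-- **The compiled evaluation** behind the two rows (`invOrdSum 29 = 682810279985309714`,
`invOrdSumLo 29 = 682810279985309685`, `invOrdSum 649 = 2338882252116474348`,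
`invOrdSumLo 649 = 2338882252116473699`; the 29-th bracket lies below `99`, the 649-th below
`999.9`, the 650-th above `1000`). Declared to the gate as `computational` (`native_decide`).
[cite: FioriKadiriSwidinsky2023, Table 1 (rows T₀ = 100, 1000)] -/
theorem recipTable2_check :
    invOrdSum 29 * 10 ^ 10 < 5922435112 * 2 ^ 60 ∧
      5922435111 * 2 ^ 60 < invOrdSumLo 29 * 10 ^ 10 ∧
      invOrdSum 649 * 10 ^ 10 < 20286569752 * 2 ^ 60 ∧
      20286569751 * 2 ^ 60 < invOrdSumLo 649 * 10 ^ 10 ∧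
      ordinate 28 + 1 < 99 * 2 ^ 240 ∧
      (ordinate 648 + 1) * 10 < 9999 * 2 ^ 240 ∧
      1000 * 2 ^ 240 < ordinate 649 := by
  native_decide

/-- `invOrdTermLo j / 2⁶⁰ ≤ 1/t₂ⱼ`. [cite: OdlyzkoTeRiele1985, §4.2 p. 151] -/
theorem invOrdTermLo_le {j : ℕ} (hj : j < 2000) : (invOrdTermLo j : ℝ) / 2 ^ 60 ≤ (t₂ j)⁻¹ := by
  have h1 := (bracket_order hj).1
  have hnn : (0 : ℤ) ≤ ordinate j := le_trans (by positivity) h1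
  have haz : ordinate j = ((ordinate j).toNat : ℤ) := (Int.toNat_of_nonneg hnn).symm
  have ha' : (ordinate j : ℝ) = ((ordinate j).toNat : ℝ) := by exact_mod_cast haz
  unfold t₂ invOrdTermLo
  rw [ha', inv_div]
  -- make `a = a_j` and `P = 2²⁴⁰` opaque (no evaluation of the data or of large powers)
  generalize (ordinate j).toNat = a
  generalize hP : (2 : ℝ) ^ 240 = P
  have hP0 : 0 < P := by rw [← hP]; exact pow_pos two_pos 240
  have h300 : ((2 ^ 300 : ℕ) : ℝ) = P * 2 ^ 60 := by
    rw [Nat.cast_pow, Nat.cast_ofNat, show (300 : ℕ) = 240 + 60 from rfl, pow_add, hP]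
  have hA : ((2 ^ 300 / (a + 1) : ℕ) : ℝ) ≤ ((2 ^ 300 : ℕ) : ℝ) / ((a + 1 : ℕ) : ℝ) :=
    Nat.cast_div_le
  rw [h300, Nat.cast_add, Nat.cast_one] at hA
  have ha0 : (0 : ℝ) < (a : ℝ) + 1 := Nat.cast_add_one_pos a
  calc ((2 ^ 300 / (a + 1) : ℕ) : ℝ) / 2 ^ 60 ≤ P * 2 ^ 60 / ((a : ℝ) + 1) / 2 ^ 60 :=
        div_le_div_of_nonneg_right hA (by positivity)
    _ = P / ((a : ℝ) + 1) := by field_simp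

/-! ### `zerosBetween 0 T` for `γ_{n−1} ≤ T < γ_n` -/

/-- **`zerosBetween 0 T = {½ + iγ_j : j < n}`** whenever `γ_{n−1} ≤ T < γ_n` (`1 ≤ n < 2000`).
[cite: OdlyzkoTeRiele1985, §4.2 p. 151] -/
theorem zerosBetween_zero_eq_image {n : ℕ} {T : ℝ} (hn0 : 1 ≤ n) (hn : n < 2000)
    (hlo : lowOrdinate (n - 1) ≤ T) (hhi : T < lowOrdinate n) :
    zerosBetween 0 T = (Finset.range n).image fun j ↦ (1 / 2 + lowOrdinate j * I : ℂ) := by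
  classical
  have hTtop : T ≤ heightT0 := (hhi.trans (lowOrdinate_pos_lt hn).2).le
  ext ρ
  rw [mem_zerosBetween le_rfl, Finset.mem_image]
  constructor
  · rintro ⟨hz, h0, h1, him, hT⟩
    obtain ⟨j, hj, rfl⟩ := zero_eq_of_im_le_heightT0 hz h0 h1 him (hT.trans hTtop)
    refine ⟨j, Finset.mem_range.2 ?_, rfl⟩
    by_contra hjn
    have hle : lowOrdinate n ≤ lowOrdinate j := by
      rcases (not_lt.1 hjn).eq_or_lt with h | h
      · rw [h]
      · exact (lowOrdinate_strictMono h hj).le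
    have : (1 / 2 + lowOrdinate j * I : ℂ).im = lowOrdinate j := by simp
    rw [this] at hT
    linarith
  · rintro ⟨j, hj, rfl⟩
    rw [Finset.mem_range] at hj
    have hj' : j < 2000 := by omega
    obtain ⟨hp, -⟩ := lowOrdinate_pos_lt hj'
    have hle : lowOrdinate j ≤ T := by
      rcases (Nat.le_sub_one_of_lt hj).eq_or_lt with h | h
      · rw [h]; exact hlo
      · exact ((lowOrdinate_strictMono h (by omega)).le.trans hlo)
    exact ⟨(lowOrdinate_spec hj').2, by simp, by norm_num, by simpa using hp, by simpa using hle⟩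

/-- The reciprocal sum over `{½ + iγ_j : j < n}` (`n ≤ 2000`; all these zeros are simple):
`Σ m(ρ)/γ = Σ_{j<n} 1/γ_j`. [cite: OdlyzkoTeRiele1985, §4.2 p. 151] -/
theorem sum_inv_image_lowOrdinate {n : ℕ} (hn : n ≤ 2000) :
    ∑ ρ ∈ (Finset.range n).image (fun j ↦ (1 / 2 + lowOrdinate j * I : ℂ)),
        (riemannZetaZeroOrder ρ : ℝ) * (1 / ρ.im) =
      ∑ j ∈ Finset.range n, (lowOrdinate j)⁻¹ := by
  classical
  have heinj : Set.InjOn (fun j ↦ (1 / 2 + lowOrdinate j * I : ℂ)) (Finset.range n : Set ℕ) := by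
    intro j hj j' hj' h
    have hj2 : j ∈ (Finset.range 2000 : Set ℕ) := by
      simp only [Finset.coe_range, Set.mem_Iio] at hj ⊢; omega
    have hj2' : j' ∈ (Finset.range 2000 : Set ℕ) := by
      simp only [Finset.coe_range, Set.mem_Iio] at hj' ⊢; omega
    exact lowOrdinate_injOn hj2 hj2' (by have := congrArg Complex.im h; simpa using this)
  rw [Finset.sum_image heinj]
  refine Finset.sum_congr rfl fun j hj ↦ ?_
  rw [Finset.mem_range] at hj
  rw [riemannZetaZeroOrder_lowOrdinate (by omega)]
  simp

/-- **Upper bound**: `Σ_{j<n} 1/γ_j ≤ invOrdSum n / 2⁶⁰` (`n ≤ 2000`).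
[cite: OdlyzkoTeRiele1985, §4.2 p. 151] -/
theorem sum_inv_lowOrdinate_le {n : ℕ} (hn : n ≤ 2000) :
    ∑ j ∈ Finset.range n, (lowOrdinate j)⁻¹ ≤ (invOrdSum n : ℝ) / 2 ^ 60 := by
  have hterm : ∀ j ∈ Finset.range n, (lowOrdinate j)⁻¹ ≤ (invOrdTerm j : ℝ) / 2 ^ 60 := by
    intro j hj
    rw [Finset.mem_range] at hj
    have hj' : j < 2000 := by omega
    have ht := (lowOrdinate_spec hj').1.1
    exact (inv_anti₀ (t₁_pos hj') ht).trans (inv_t₁_le hj')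
  refine (Finset.sum_le_sum hterm).trans ?_
  rw [← Finset.sum_div, invOrdSum_eq]
  push_cast
  exact le_rfl

/-- **Lower bound**: `invOrdSumLo n / 2⁶⁰ ≤ Σ_{j<n} 1/γ_j` (`n ≤ 2000`).
[cite: OdlyzkoTeRiele1985, §4.2 p. 151] -/
theorem le_sum_inv_lowOrdinate {n : ℕ} (hn : n ≤ 2000) :
    (invOrdSumLo n : ℝ) / 2 ^ 60 ≤ ∑ j ∈ Finset.range n, (lowOrdinate j)⁻¹ := by
  have hterm : ∀ j ∈ Finset.range n, (invOrdTermLo j : ℝ) / 2 ^ 60 ≤ (lowOrdinate j)⁻¹ := by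
    intro j hj
    rw [Finset.mem_range] at hj
    have hj' : j < 2000 := by omega
    have ht := (lowOrdinate_spec hj').1.2
    have hp := (lowOrdinate_pos_lt hj').1
    exact (invOrdTermLo_le hj').trans (inv_anti₀ hp ht)
  refine le_trans ?_ (Finset.sum_le_sum hterm)
  rw [← Finset.sum_div, invOrdSumLo_eq]
  push_cast
  exact le_rfl

/-- Truncations are monotone: for `T ≤ T'`, `Σ_{0<γ≤T} m(ρ)/γ ≤ Σ_{0<γ≤T'} m(ρ)/γ`.
[cite: FioriKadiriSwidinsky2023, eq. (2.4)] -/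
theorem sum_inv_zerosBetween_zero_mono {T T' : ℝ} (h : T ≤ T') :
    ∑ ρ ∈ zerosBetween 0 T, (riemannZetaZeroOrder ρ : ℝ) * (1 / ρ.im) ≤
      ∑ ρ ∈ zerosBetween 0 T', (riemannZetaZeroOrder ρ : ℝ) * (1 / ρ.im) := by
  have hsub : zerosBetween 0 T ⊆ zerosBetween 0 T' := by
    intro ρ hρ
    obtain ⟨hz, ha, hb, hc, hd⟩ := (mem_zerosBetween le_rfl).1 hρ
    exact (mem_zerosBetween le_rfl).2 ⟨hz, ha, hb, hc, hd.trans h⟩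
  refine Finset.sum_le_sum_of_subset_of_nonneg hsub fun ρ hρ _ ↦ ?_
  have hm := zeroOrder_nonneg_of_mem_zerosBetween le_rfl hρ
  obtain ⟨-, -, -, h3, -⟩ := (mem_zerosBetween le_rfl).1 hρ
  positivity

/-! ### Row `T₀ = 100`: `N(100) = 29` -/

/-- `zerosBetween 0 99 = {½ + iγ_j : j < 29}` (the 29-th zero is `γ ≈ 98.83 < 99`, the 30-th
`≈ 101.32 > 100`). [cite: OdlyzkoTeRiele1985, §4.2 p. 151] -/
theorem zerosBetween_zero_99 :
    zerosBetween 0 99 = (Finset.range 29).image fun j ↦ (1 / 2 + lowOrdinate j * I : ℂ) := by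
  have hchk := recipTable2_check.2.2.2.2.1
  have h2p : (0 : ℝ) < 2 ^ 240 := by positivity
  have h28 : t₂ 28 < 99 := by
    unfold t₂; rw [div_lt_iff₀ h2p]; exact_mod_cast hchk
  have hlo : lowOrdinate 28 ≤ 99 := ((lowOrdinate_spec (by norm_num)).1.2.trans h28.le)
  have hhi : (99 : ℝ) < lowOrdinate 29 := by linarith [lowOrdinate_28_lt_100.2]
  exact zerosBetween_zero_eq_image (n := 29) (by norm_num) (by norm_num) hlo hhi

end SchoenfeldBound

open SchoenfeldBound ZetaNumerics.Mertens MertensCertificate.ZetaNumerics.Mertens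
  Literature.NumberTheory.LFunctions.MertensZeroCertificate

/-- **FKS Table 1, row `T₀ = 100`, PROVED**: `Σ_{0<γ<100} 1/γ ∈ (0.5922435112 − 10⁻¹⁰, 0.5922435112)`,
in the form of the named fact `FioriKadiriSwidinsky2023_table2`: every truncation `Σ_{0<γ≤T} m(ρ)/γ`
with `T < 100` is `< 0.5922435112`, and the truncation at `T = 99` is `> 0.5922435112 − 10⁻¹⁰`.
[cite: FioriKadiriSwidinsky2023, Table 1 (row T₀ = 100) and eq. (2.4)] -/
theorem FioriKadiriSwidinsky2023_table2_row100 :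
    (∀ T : ℝ, T < 100 →
        ∑ ρ ∈ zerosBetween 0 T, (riemannZetaZeroOrder ρ : ℝ) * (1 / ρ.im) < 0.5922435112) ∧
      ∃ T : ℝ, T < 100 ∧
        0.5922435112 - 1e-10 < ∑ ρ ∈ zerosBetween 0 T, (riemannZetaZeroOrder ρ : ℝ) * (1 / ρ.im) := by
  obtain ⟨hup, hlo, -⟩ := recipTable2_check
  have hsum : ∑ ρ ∈ zerosBetween 0 100, (riemannZetaZeroOrder ρ : ℝ) * (1 / ρ.im) =
      ∑ j ∈ Finset.range 29, (lowOrdinate j)⁻¹ := by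
    rw [zerosBetween_zero_100]; exact sum_inv_image_lowOrdinate (by norm_num)
  have hsum99 : ∑ ρ ∈ zerosBetween 0 99, (riemannZetaZeroOrder ρ : ℝ) * (1 / ρ.im) =
      ∑ j ∈ Finset.range 29, (lowOrdinate j)⁻¹ := by
    rw [zerosBetween_zero_99]; exact sum_inv_image_lowOrdinate (by norm_num)
  have hU := sum_inv_lowOrdinate_le (n := 29) (by norm_num)
  have hL := le_sum_inv_lowOrdinate (n := 29) (by norm_num)
  generalize invOrdSum 29 = N at hup hU
  generalize invOrdSumLo 29 = M at hlo hL
  have hup' : (N : ℝ) * 10 ^ 10 < 5922435112 * 2 ^ 60 := by exact_mod_cast hup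
  have hlo' : (5922435111 : ℝ) * 2 ^ 60 < (M : ℝ) * 10 ^ 10 := by exact_mod_cast hlo
  have hU' : (N : ℝ) / 2 ^ 60 < 0.5922435112 := by
    rw [div_lt_iff₀ (by positivity)]; norm_num at hup' ⊢; linarith
  have hL' : (0.5922435112 : ℝ) - 1e-10 < (M : ℝ) / 2 ^ 60 := by
    rw [lt_div_iff₀ (by positivity)]; norm_num at hlo' ⊢; linarith
  refine ⟨fun T hT ↦ ?_, ⟨99, by norm_num, ?_⟩⟩
  · calc ∑ ρ ∈ zerosBetween 0 T, (riemannZetaZeroOrder ρ : ℝ) * (1 / ρ.im)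
        ≤ ∑ ρ ∈ zerosBetween 0 100, (riemannZetaZeroOrder ρ : ℝ) * (1 / ρ.im) :=
          sum_inv_zerosBetween_zero_mono hT.le
      _ = ∑ j ∈ Finset.range 29, (lowOrdinate j)⁻¹ := hsum
      _ < 0.5922435112 := hU.trans_lt hU'
  · rw [hsum99]
    exact hL'.trans_le hL

/-! ### Row `T₀ = 1000`: `N(1000) = 649` -/

namespace SchoenfeldBound

/-- `γ₆₄₈ < 999.9` and `1000 < γ₆₄₉` (0-indexed: the 649-th zero is `≈ 999.79`, the 650-th
`≈ 1001.35`). [cite: OdlyzkoTeRiele1985, §4.2 p. 151] -/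
theorem lowOrdinate_648_lt : lowOrdinate 648 < 9999 / 10 ∧ 1000 < lowOrdinate 649 := by
  obtain ⟨-, -, -, -, -, h1, h2⟩ := recipTable2_check
  have h2p : (0 : ℝ) < 2 ^ 240 := by positivity
  have ha : t₂ 648 < 9999 / 10 := by
    unfold t₂; rw [div_lt_iff₀ h2p]
    have : ((ordinate 648 : ℝ) + 1) * 10 < 9999 * 2 ^ 240 := by exact_mod_cast h1
    linarith
  have hb : 1000 < t₁ 649 := by
    unfold t₁; rw [lt_div_iff₀ h2p]; exact_mod_cast h2
  exact ⟨(lowOrdinate_spec (by norm_num)).1.2.trans_lt ha,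
    hb.trans_le (lowOrdinate_spec (by norm_num)).1.1⟩

/-- `zerosBetween 0 1000 = {½ + iγ_j : j < 649}` (`N(1000) = 649`). [cite: OdlyzkoTeRiele1985, §4.2 p. 151] -/
theorem zerosBetween_zero_1000 :
    zerosBetween 0 1000 = (Finset.range 649).image fun j ↦ (1 / 2 + lowOrdinate j * I : ℂ) := by
  obtain ⟨h1, h2⟩ := lowOrdinate_648_lt
  exact zerosBetween_zero_eq_image (n := 649) (by norm_num) (by norm_num) (by linarith) h2

/-- `zerosBetween 0 999.9 = {½ + iγ_j : j < 649}`. [cite: OdlyzkoTeRiele1985, §4.2 p. 151] -/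
theorem zerosBetween_zero_9999 :
    zerosBetween 0 (9999 / 10) = (Finset.range 649).image fun j ↦ (1 / 2 + lowOrdinate j * I : ℂ) := by
  obtain ⟨h1, h2⟩ := lowOrdinate_648_lt
  exact zerosBetween_zero_eq_image (n := 649) (by norm_num) (by norm_num) h1.le (by linarith)

end SchoenfeldBound

/-- **FKS Table 1, row `T₀ = 1000`, PROVED**: `Σ_{0<γ<1000} 1/γ ∈ (2.0286569752 − 10⁻¹⁰, 2.0286569752)`,
in the form of the named fact `FioriKadiriSwidinsky2023_table2`: every truncation `Σ_{0<γ≤T} m(ρ)/γ`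
with `T < 1000` is `< 2.0286569752`, and the truncation at `T = 999.9` is `> 2.0286569752 − 10⁻¹⁰`.
[cite: FioriKadiriSwidinsky2023, Table 1 (row T₀ = 1000) and eq. (2.4)] -/
theorem FioriKadiriSwidinsky2023_table2_row1000 :
    (∀ T : ℝ, T < 1000 →
        ∑ ρ ∈ zerosBetween 0 T, (riemannZetaZeroOrder ρ : ℝ) * (1 / ρ.im) < 2.0286569752) ∧
      ∃ T : ℝ, T < 1000 ∧
        2.0286569752 - 1e-10 < ∑ ρ ∈ zerosBetween 0 T, (riemannZetaZeroOrder ρ : ℝ) * (1 / ρ.im) := by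
  obtain ⟨-, -, hup, hlo, -⟩ := recipTable2_check
  have hsum : ∑ ρ ∈ zerosBetween 0 1000, (riemannZetaZeroOrder ρ : ℝ) * (1 / ρ.im) =
      ∑ j ∈ Finset.range 649, (lowOrdinate j)⁻¹ := by
    rw [zerosBetween_zero_1000]; exact sum_inv_image_lowOrdinate (by norm_num)
  have hsum9999 : ∑ ρ ∈ zerosBetween 0 (9999 / 10), (riemannZetaZeroOrder ρ : ℝ) * (1 / ρ.im) =
      ∑ j ∈ Finset.range 649, (lowOrdinate j)⁻¹ := by
    rw [zerosBetween_zero_9999]; exact sum_inv_image_lowOrdinate (by norm_num)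
  have hU := sum_inv_lowOrdinate_le (n := 649) (by norm_num)
  have hL := le_sum_inv_lowOrdinate (n := 649) (by norm_num)
  generalize invOrdSum 649 = N at hup hU
  generalize invOrdSumLo 649 = M at hlo hL
  have hup' : (N : ℝ) * 10 ^ 10 < 20286569752 * 2 ^ 60 := by exact_mod_cast hup
  have hlo' : (20286569751 : ℝ) * 2 ^ 60 < (M : ℝ) * 10 ^ 10 := by exact_mod_cast hlo
  have hU' : (N : ℝ) / 2 ^ 60 < 2.0286569752 := by
    rw [div_lt_iff₀ (by positivity)]; norm_num at hup' ⊢; linarith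
  have hL' : (2.0286569752 : ℝ) - 1e-10 < (M : ℝ) / 2 ^ 60 := by
    rw [lt_div_iff₀ (by positivity)]; norm_num at hlo' ⊢; linarith
  refine ⟨fun T hT ↦ ?_, ⟨9999 / 10, by norm_num, ?_⟩⟩
  · calc ∑ ρ ∈ zerosBetween 0 T, (riemannZetaZeroOrder ρ : ℝ) * (1 / ρ.im)
        ≤ ∑ ρ ∈ zerosBetween 0 1000, (riemannZetaZeroOrder ρ : ℝ) * (1 / ρ.im) :=
          sum_inv_zerosBetween_zero_mono hT.le
      _ = ∑ j ∈ Finset.range 649, (lowOrdinate j)⁻¹ := hsum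
      _ < 2.0286569752 := hU.trans_lt hU'
  · rw [hsum9999]
    exact hL'.trans_le hL

end Literature.NumberTheory.LFunctions

end
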